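import Literature.Probability.Percolation.InequalitiesProofs
import HarnessLib

/-!
# The BK inequality for `k`-out-of-`n` measures (van den Berg–Jonasson 2012)

Topic `Literature/Probability/LatticeModels`. Source: J. van den Berg, J. Jonasson, *A BK inequality
for randomly drawn subsets of fixed size*, Probab. Theory Related Fields 154 (2012) 835–844,
arXiv:1105.3862 [VandenbergJonasson2011] (read in the arXiv version, §§1–3, pp. 2–5).

**Printed statement** (§1, Theorem 2, p. 2): "For all `n`, all `k ≤ n`, and all increasing
`A, B ⊂ {0,1}^n`, `P_{k,n}(A □ B) ≤ P_{k,n}(A) P_{k,n}(B)`", where `P_{k,n}` ("the `k`-out-of-`n`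
measure") is the distribution on `{0,1}^n` that assigns equal probability to all `ω` with exactly
`k` ones (p. 2) and `A □ B` is disjoint occurrence ("As far as we know, this is the first substantial
example of a non-product BK measure", p. 2).

We prove it in the equivalent COUNTING form (multiply by `|Ω_{k,n}|²`):
`|(A □ B) ∩ Ω_{k,n}| · |Ω_{k,n}| ≤ |A ∩ Ω_{k,n}| · |B ∩ Ω_{k,n}|` (`bk_kOutOfN_card`), on the cube
`α → Bool` over any finite index type `α`, with `A □ B` in the form used by the tree's flip lemma
`Literature.Probability.Percolation.reimer_flip_card_le` (`A □ B = {x | ∃ K, [x]_K ⊆ A ∧ [x]_{Kᶜ} ⊆ B}`,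
which for increasing — indeed for all — `A, B` is the usual disjoint-occurrence event).

## The printed proof, followed here (§3, pp. 3–5)

* **Proposition 5** (the "encoded form" of Reimer's flip lemma `|A □ B| ≤ |A ∩ B̄|`, p. 4): for
  increasing `A, B ⊆ {0,1}^m`, `m` even, counting only configurations with exactly one `1` in each of
  the pairs `{2i-1, 2i}`: `|(A □ B) ∩ Ω̂| ≤ |A ∩ B̄ ∩ Ω̂|`.  Proof: the bijection
  `T : Ω̂ → {0,1}^{m/2}` and the two checks (check1) `T((A □ B) ∩ Ω̂) ⊆ T(A ∩ Ω̂) □ T(B ∩ Ω̂)`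
  (uses that `A, B` are increasing: witnesses may be shrunk to the `1`s, which lie in distinct pairs)
  and (check2) `T(A ∩ B̄ ∩ Ω̂) = T(A ∩ Ω̂) ∩ overline{T(B ∩ Ω̂)}`; then Reimer.  Here: `encodedReimer`,
  for an arbitrary PAIRING `φ : α ≃ β × Bool` of the coordinates (the paper's relabelled `Ω̂^π`).
* **Proposition 4** (p. 3): `P_{m/2,m}(A □ B) ≤ P_{m/2,m}(A ∩ B̄)` — "`P_{m/2,m}` is a convex
  combination of the `P̂^π`'s" (p. 5).  Here: `balancedReimer`, by summing `encodedReimer` over all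
  pairings `φ` and observing that the number of pairings compatible with a balanced configuration does
  not depend on the configuration (transitivity of the coordinate permutations).
* **Theorem 2 from Proposition 4** (§3.1, pp. 3–4): the cells `W_α` of `Ω_{k,n} × Ω_{k,n}`
  (pairs agreeing on `K` and complementary off `K`), on each of which the count reduces to
  Proposition 4 for the sections `A(α)`, `B(α)` on the cube `{0,1}^{K^c}`, using
  `(A □ B)(α) ⊆ A(α) □ B(α)`.  Here: `card_mul_card_eq_sum_mirror` (the cell decomposition as the
  bijection `(ω, ω') ↦ (K, ω)`, `ω' = ` "`ω` on `K`, `ω̄` off `K`") and `bk_kOutOfN_card`.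

Not transcribed: the weighted (conditional Poisson) and product extensions of §4.

## References

* J. van den Berg, J. Jonasson, PTRF 154 (2012) 835–844, arXiv:1105.3862, Thm. 2, Props. 4–5.
  [VandenbergJonasson2011]
* D. Reimer, *Proof of the van den Berg–Kesten conjecture*, Combin. Probab. Comput. 9 (2000) 27–32,
  Thm. 1.2 (the flip lemma; tree: `reimer_flip_card_le`). [ReimerCPC2000]
-/

namespace Literature.Probability.LatticeModels

namespace VandenBergJonasson2012

open Finset

variable {α : Type*} [Fintype α] [DecidableEq α]

/-! ### The objects on the cube `α → Bool` -/

/-- Disjoint occurrence on the cube, in the form of the tree's flip lemma: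
`A □ B = {x | ∃ K, [x]_K ⊆ A ∧ [x]_{Kᶜ} ⊆ B}`. [cite: VandenbergJonasson2011, §1 (definition of □)] -/
def cubeBox (A B : Finset (α → Bool)) : Finset (α → Bool) :=
  univ.filter fun x => ∃ K : Finset α,
    (∀ z : α → Bool, (∀ i ∈ K, z i = x i) → z ∈ A) ∧
    (∀ z : α → Bool, (∀ i, i ∉ K → z i = x i) → z ∈ B)

/-- Membership in `cubeBox`. [cite: VandenbergJonasson2011, §1] -/
theorem mem_cubeBox {A B : Finset (α → Bool)} {x : α → Bool} :
    x ∈ cubeBox A B ↔ ∃ K : Finset α,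
      (∀ z : α → Bool, (∀ i ∈ K, z i = x i) → z ∈ A) ∧
      (∀ z : α → Bool, (∀ i, i ∉ K → z i = x i) → z ∈ B) := by
  simp [cubeBox]

/-- Coordinatewise complement `x̄`. [cite: VandenbergJonasson2011, §2] -/
def flipAll (x : α → Bool) : α → Bool := fun i => !x i

omit [Fintype α] [DecidableEq α] in
/-- `flipAll` is an involution. [folklore] -/
@[simp] theorem flipAll_flipAll (x : α → Bool) : flipAll (flipAll x) = x := by
  funext i; simp [flipAll]

/-- The reflected event `B̄ = {x̄ | x ∈ B}`. [cite: VandenbergJonasson2011, §2] -/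
def cubeFlip (B : Finset (α → Bool)) : Finset (α → Bool) := B.image flipAll

omit [DecidableEq α] in
/-- `x ∈ B̄ ↔ x̄ ∈ B`. [folklore] -/
theorem mem_cubeFlip {B : Finset (α → Bool)} {x : α → Bool} : x ∈ cubeFlip B ↔ flipAll x ∈ B := by
  unfold cubeFlip
  constructor
  · rintro h
    obtain ⟨y, hy, rfl⟩ := Finset.mem_image.1 h
    rwa [flipAll_flipAll]
  · intro h
    exact Finset.mem_image.2 ⟨flipAll x, h, flipAll_flipAll x⟩

omit [Fintype α] [DecidableEq α] in
/-- Increasing events of the cube (`false < true` coordinatewise). [cite: VandenbergJonasson2011, §1] -/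
def IsIncr (A : Finset (α → Bool)) : Prop := ∀ ⦃x y : α → Bool⦄, x ≤ y → x ∈ A → y ∈ A

/-- The set of coordinates equal to `1`. [cite: VandenbergJonasson2011, §1 (supp ω)] -/
def ones (x : α → Bool) : Finset α := univ.filter fun i => x i = true

/-- The layer `Ω_{k,n}`: configurations with exactly `k` ones. [cite: VandenbergJonasson2011, §1] -/
def layer (k : ℕ) : Finset (α → Bool) := univ.filter fun x => (ones x).card = k

/-- Balanced configurations: as many ones as zeros. [cite: VandenbergJonasson2011, §3 (Ω_{m/2,m})] -/
def Balanced (x : α → Bool) : Prop := 2 * (ones x).card = Fintype.card α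

/-- Balance is decidable (a cardinality equation). [folklore] -/
instance (x : α → Bool) : Decidable (Balanced x) := by unfold Balanced; infer_instance

/-! ### Proposition 5: the encoded flip lemma for a pairing of the coordinates -/

section Pairing

variable {β : Type*} [Fintype β] [DecidableEq β]

/-- The encoding `T⁻¹`: a configuration on the pairs becomes a configuration with exactly one `1` per
pair (`1 ↦ (1,0)`, `0 ↦ (0,1)`). [cite: VandenbergJonasson2011, §3.2 (the bijection T)] -/
def enc (φ : α ≃ β × Bool) (y : β → Bool) : α → Bool :=
  fun a => if (φ a).2 then y (φ a).1 else !y (φ a).1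

/-- The configurations with exactly one `1` in each pair of the pairing `φ` (the paper's `Ω̂^π`).
[cite: VandenbergJonasson2011, §3.2] -/
def pairedSet (φ : α ≃ β × Bool) : Finset (α → Bool) :=
  univ.filter fun x => ∀ b, x (φ.symm (b, true)) ≠ x (φ.symm (b, false))

omit [Fintype α] [DecidableEq α] [Fintype β] [DecidableEq β] in
/-- Values of the encoding on the two members of a pair. [cite: VandenbergJonasson2011, §3.2] -/
theorem enc_symm_apply (φ : α ≃ β × Bool) (y : β → Bool) (b : β) (s : Bool) :
    enc φ y (φ.symm (b, s)) = if s then y b else !y b := by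
  simp [enc]

omit [Fintype α] [DecidableEq α] [Fintype β] [DecidableEq β] in
/-- `enc` commutes with complementation. [cite: VandenbergJonasson2011, §3.2 (check2)] -/
theorem flipAll_enc (φ : α ≃ β × Bool) (y : β → Bool) : flipAll (enc φ y) = enc φ (flipAll y) := by
  funext a
  unfold flipAll enc
  split_ifs <;> simp

omit [Fintype α] [DecidableEq α] [Fintype β] [DecidableEq β] in
/-- `enc` is injective. [folklore] -/
theorem enc_injective (φ : α ≃ β × Bool) : Function.Injective (enc φ) := by
  intro y y' h
  funext b
  have := congrFun h (φ.symm (b, true))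
  simpa [enc_symm_apply] using this

/-- The image of the encoding is the paired set. [cite: VandenbergJonasson2011, §3.2 (T is a bijection)] -/
theorem inter_pairedSet_eq_image (φ : α ≃ β × Bool) (X : Finset (α → Bool)) :
    X ∩ pairedSet φ = (univ.filter fun y : β → Bool => enc φ y ∈ X).image (enc φ) := by
  ext x
  simp only [Finset.mem_inter, pairedSet, Finset.mem_filter, Finset.mem_univ, true_and,
    Finset.mem_image]
  constructor
  · rintro ⟨hxX, hx⟩
    refine ⟨fun b => x (φ.symm (b, true)), ?_, ?_⟩
    · convert hxX using 1
      funext a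
      obtain ⟨⟨b, s⟩, rfl⟩ : ∃ q, a = φ.symm q := ⟨φ a, (φ.symm_apply_apply a).symm⟩
      rw [enc_symm_apply]
      cases s
      · have h := hx b
        simp only [Bool.false_eq_true, if_false]
        cases h1 : x (φ.symm (b, true)) <;> cases h2 : x (φ.symm (b, false)) <;> simp_all
      · simp
    · funext a
      obtain ⟨⟨b, s⟩, rfl⟩ : ∃ q, a = φ.symm q := ⟨φ a, (φ.symm_apply_apply a).symm⟩
      rw [enc_symm_apply]
      cases s
      · have h := hx b
        simp only [Bool.false_eq_true, if_false]
        cases h1 : x (φ.symm (b, true)) <;> cases h2 : x (φ.symm (b, false)) <;> simp_all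
      · simp
  · rintro ⟨y, hy, rfl⟩
    refine ⟨hy, fun b => ?_⟩
    rw [enc_symm_apply, enc_symm_apply]
    cases y b <;> simp

/-- Counting through the encoding: `|X ∩ Ω̂^φ| = |{y | enc y ∈ X}|`. [cite: VandenbergJonasson2011, §3.2] -/
theorem card_inter_pairedSet (φ : α ≃ β × Bool) (X : Finset (α → Bool)) :
    (X ∩ pairedSet φ).card = (univ.filter fun y : β → Bool => enc φ y ∈ X).card := by
  rw [inter_pairedSet_eq_image, Finset.card_image_of_injective _ (enc_injective φ)]

/-- **(check1)** of the paper: for increasing `A, B`, `T((A □ B) ∩ Ω̂) ⊆ T(A ∩ Ω̂) □ T(B ∩ Ω̂)`.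
[cite: VandenbergJonasson2011, §3.2 (check1)] -/
theorem check1 (φ : α ≃ β × Bool) {A B : Finset (α → Bool)} (hA : IsIncr A) (hB : IsIncr B) :
    (univ.filter fun y : β → Bool => enc φ y ∈ cubeBox A B) ⊆
      cubeBox (univ.filter fun y : β → Bool => enc φ y ∈ A)
        (univ.filter fun y : β → Bool => enc φ y ∈ B) := by
  intro y hy
  rw [Finset.mem_filter] at hy
  obtain ⟨K, hKA, hKB⟩ := mem_cubeBox.1 hy.2
  rw [mem_cubeBox]
  -- the pairs having a member in `K` at which `enc y` equals `1`
  refine ⟨univ.filter fun b => ∃ s : Bool, φ.symm (b, s) ∈ K ∧ enc φ y (φ.symm (b, s)) = true,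
    ?_, ?_⟩
  · intro z hz
    rw [Finset.mem_filter]
    refine ⟨Finset.mem_univ _, ?_⟩
    -- compare with `enc y` lowered to `enc z` off the ones of `K`
    have hz' : (fun a => if a ∈ K then enc φ y a else enc φ z a) ∈ A :=
      hKA _ fun i hi => by simp [hi]
    refine hA ?_ hz'
    intro a
    obtain ⟨⟨b, s⟩, rfl⟩ : ∃ q, a = φ.symm q := ⟨φ a, (φ.symm_apply_apply a).symm⟩
    by_cases ha : φ.symm (b, s) ∈ K
    · simp only [ha, if_true]
      by_cases h1 : enc φ y (φ.symm (b, s)) = true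
      · have hb : b ∈ univ.filter fun b => ∃ s : Bool, φ.symm (b, s) ∈ K ∧
            enc φ y (φ.symm (b, s)) = true :=
          Finset.mem_filter.2 ⟨Finset.mem_univ _, s, ha, h1⟩
        have hzb := hz b hb
        have : enc φ z (φ.symm (b, s)) = enc φ y (φ.symm (b, s)) := by
          rw [enc_symm_apply, enc_symm_apply, hzb]
        rw [this]
      · rw [Bool.not_eq_true] at h1
        rw [h1]; exact Bool.false_le _
    · simp only [ha, if_false]; exact le_rfl
  · intro z hz
    rw [Finset.mem_filter]
    refine ⟨Finset.mem_univ _, ?_⟩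
    have hz' : (fun a => if a ∉ K then enc φ y a else enc φ z a) ∈ B :=
      hKB _ fun i hi => by simp [hi]
    refine hB ?_ hz'
    intro a
    obtain ⟨⟨b, s⟩, rfl⟩ : ∃ q, a = φ.symm q := ⟨φ a, (φ.symm_apply_apply a).symm⟩
    by_cases ha : φ.symm (b, s) ∈ K
    · simp only [ha, not_true_eq_false, if_false]; exact le_rfl
    · simp only [ha, not_false_eq_true, if_true]
      by_cases h1 : enc φ y (φ.symm (b, s)) = true
      · -- then `b` is not in the witness set, so `z b = y b`
        have hb : b ∉ univ.filter fun b => ∃ s : Bool, φ.symm (b, s) ∈ K ∧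
            enc φ y (φ.symm (b, s)) = true := by
          intro hb
          obtain ⟨s', hs'K, hs'1⟩ := (Finset.mem_filter.1 hb).2
          by_cases hss : s' = s
          · subst hss; exact ha hs'K
          · -- the other member of the pair carries a `0`
            rw [enc_symm_apply] at h1 hs'1
            cases s <;> cases s' <;> simp_all
        have hzb := hz b hb
        have : enc φ z (φ.symm (b, s)) = enc φ y (φ.symm (b, s)) := by
          rw [enc_symm_apply, enc_symm_apply, hzb]
        rw [this]
      · rw [Bool.not_eq_true] at h1
        rw [h1]; exact Bool.false_le _

omit [DecidableEq α] in
/-- **(check2)** of the paper (the inclusion needed): `T(A ∩ Ω̂) ∩ overline{T(B ∩ Ω̂)} ⊆ T(A ∩ B̄ ∩ Ω̂)`.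
[cite: VandenbergJonasson2011, §3.2 (check2)] -/
theorem check2 (φ : α ≃ β × Bool) (A B : Finset (α → Bool)) :
    (univ.filter fun y : β → Bool => enc φ y ∈ A) ∩
        cubeFlip (univ.filter fun y : β → Bool => enc φ y ∈ B) ⊆
      univ.filter fun y : β → Bool => enc φ y ∈ A ∩ cubeFlip B := by
  intro y hy
  rw [Finset.mem_inter, Finset.mem_filter, mem_cubeFlip, Finset.mem_filter] at hy
  rw [Finset.mem_filter, Finset.mem_inter, mem_cubeFlip, flipAll_enc]
  exact ⟨Finset.mem_univ _, hy.1.2, hy.2.2⟩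

/-- **Proposition 5** (van den Berg–Jonasson 2012, the encoded flip lemma), for an arbitrary pairing
`φ` of the coordinates: for increasing `A, B`, `|(A □ B) ∩ Ω̂^φ| ≤ |A ∩ B̄ ∩ Ω̂^φ|`.
[cite: VandenbergJonasson2011, Prop. 5] -/
theorem encodedReimer (φ : α ≃ β × Bool) {A B : Finset (α → Bool)} (hA : IsIncr A) (hB : IsIncr B) :
    (cubeBox A B ∩ pairedSet φ).card ≤ (A ∩ cubeFlip B ∩ pairedSet φ).card := by
  rw [card_inter_pairedSet, card_inter_pairedSet]
  set A' := univ.filter fun y : β → Bool => enc φ y ∈ A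
  set B' := univ.filter fun y : β → Bool => enc φ y ∈ B
  calc (univ.filter fun y : β → Bool => enc φ y ∈ cubeBox A B).card
      ≤ (cubeBox A' B').card := Finset.card_le_card (check1 φ hA hB)
    _ ≤ (A' ∩ cubeFlip B').card := by
        unfold cubeBox cubeFlip flipAll
        exact Literature.Probability.Percolation.reimer_flip_card_le A' B'
    _ ≤ _ := Finset.card_le_card (check2 φ A B)

end Pairing

/-! ### Proposition 4: the flip lemma on the balanced layer -/

section Balanced

variable {β : Type*} [Fintype β] [DecidableEq β]

omit [DecidableEq β] in
/-- A configuration with exactly one `1` per pair is balanced. [cite: VandenbergJonasson2011, §3.2] -/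
theorem balanced_of_mem_pairedSet (φ : α ≃ β × Bool) {x : α → Bool} (hx : x ∈ pairedSet φ) :
    Balanced x := by
  have hx' : ∀ b, x (φ.symm (b, true)) ≠ x (φ.symm (b, false)) := by
    simpa [pairedSet] using hx
  -- the `1` of each pair
  set g : β → α := fun b => if x (φ.symm (b, true)) = true then φ.symm (b, true) else φ.symm (b, false)
    with hg
  have hginj : Function.Injective g := by
    intro b b' h
    have h1 : ∀ b, (φ (g b)).1 = b := by
      intro b; simp only [hg]; split_ifs <;> simp
    have := congrArg (fun a => (φ a).1) h
    simpa [h1] using this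
  have hones : ones x = univ.image g := by
    ext a
    simp only [ones, Finset.mem_filter, Finset.mem_univ, true_and, Finset.mem_image]
    constructor
    · intro ha
      obtain ⟨⟨b, s⟩, rfl⟩ : ∃ q, a = φ.symm q := ⟨φ a, (φ.symm_apply_apply a).symm⟩
      refine ⟨b, ?_⟩
      cases s
      · have h2 : x (φ.symm (b, true)) = false := by
          have := hx' b; rw [ha] at this; simpa using this
        simp [hg, h2]
      · simp [hg, ha]
    · rintro ⟨b, rfl⟩
      simp only [hg]
      have := hx' b
      cases h1 : x (φ.symm (b, true)) <;> cases h2 : x (φ.symm (b, false)) <;> simp_all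
  unfold Balanced
  rw [hones, Finset.card_image_of_injective _ hginj, Finset.card_univ,
    Fintype.card_congr φ, Fintype.card_prod, Fintype.card_bool]
  ring

omit [DecidableEq β] in
/-- Relabelling the coordinates: `x ∘ σ ∈ Ω̂^{σ.trans φ} ↔ x ∈ Ω̂^φ`. [cite: VandenbergJonasson2011, §3.2 (relabelling)] -/
theorem comp_mem_pairedSet_iff (σ : α ≃ α) (φ : α ≃ β × Bool) (x : α → Bool) :
    (x ∘ σ) ∈ pairedSet (σ.trans φ) ↔ x ∈ pairedSet φ := by
  simp [pairedSet]

/-- Left translation of pairings by a coordinate permutation. [folklore] -/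
def transLeft (σ : α ≃ α) : (α ≃ β × Bool) ≃ (α ≃ β × Bool) where
  toFun ψ := σ.symm.trans ψ
  invFun φ := σ.trans φ
  left_inv ψ := by ext a <;> simp
  right_inv φ := by ext a <;> simp

/-- The number of pairings compatible with `x ∘ σ` equals that for `x`. [cite: VandenbergJonasson2011, §3.2] -/
theorem card_pairings_comp (σ : α ≃ α) (x : α → Bool) :
    (univ.filter fun φ : α ≃ β × Bool => (x ∘ σ) ∈ pairedSet φ).card =
      (univ.filter fun φ : α ≃ β × Bool => x ∈ pairedSet φ).card := by
  refine Finset.card_equiv (transLeft (β := β) σ) fun ψ => ?_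
  simp only [Finset.mem_filter, Finset.mem_univ, true_and]
  show x ∘ σ ∈ pairedSet ψ ↔ x ∈ pairedSet (σ.symm.trans ψ)
  have h : (x ∘ σ) ∈ pairedSet (σ.trans (σ.symm.trans ψ)) ↔ x ∈ pairedSet (σ.symm.trans ψ) :=
    comp_mem_pairedSet_iff σ (σ.symm.trans ψ) x
  have hσ : σ.trans (σ.symm.trans ψ) = ψ := by ext a <;> simp
  rw [hσ] at h
  exact h

omit [DecidableEq α] in
/-- Coordinate permutations act transitively on balanced configurations. [folklore] -/
theorem exists_perm_of_balanced {x x₀ : α → Bool} (hx : Balanced x) (hx₀ : Balanced x₀) :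
    ∃ σ : α ≃ α, x ∘ σ = x₀ := by
  have hc1 : Fintype.card {a // x₀ a = true} = Fintype.card {a // x a = true} := by
    rw [Fintype.card_subtype, Fintype.card_subtype]
    unfold Balanced ones at hx hx₀
    omega
  have hc2 : Fintype.card {a // ¬ x₀ a = true} = Fintype.card {a // ¬ x a = true} := by
    rw [Fintype.card_subtype_compl, Fintype.card_subtype_compl, hc1]
  let e₁ : {a // x₀ a = true} ≃ {a // x a = true} := Fintype.equivOfCardEq hc1
  let e₂ : {a // ¬ x₀ a = true} ≃ {a // ¬ x a = true} := Fintype.equivOfCardEq hc2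
  refine ⟨(Equiv.sumCompl fun a => x₀ a = true).symm.trans
    ((e₁.sumCongr e₂).trans (Equiv.sumCompl fun a => x a = true)), ?_⟩
  funext a
  simp only [Function.comp, Equiv.trans_apply]
  by_cases h : x₀ a = true
  · rw [Equiv.sumCompl_symm_apply_of_pos (p := fun a => x₀ a = true) h,
      Equiv.sumCongr_apply, Sum.map_inl, Equiv.sumCompl_apply_inl, h]
    exact (e₁ ⟨a, h⟩).2
  · rw [Equiv.sumCompl_symm_apply_of_neg (p := fun a => x₀ a = true) h,
      Equiv.sumCongr_apply, Sum.map_inr, Equiv.sumCompl_apply_inr]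
    have h2 : ¬ x ((e₂ ⟨a, h⟩ : {a // ¬ x a = true}) : α) = true := (e₂ ⟨a, h⟩).2
    rw [Bool.not_eq_true] at h h2
    rw [h, h2]

/-- **Averaging identity** ("`P_{m/2,m}` is a convex combination of the `P̂^π`"): summed over all
pairings, `|X ∩ Ω̂^φ|` counts every balanced configuration of `X` the same number of times.
[cite: VandenbergJonasson2011, §3.2 (proof of Prop. 4)] -/
theorem sum_card_inter_pairedSet {x₀ : α → Bool} (hx₀ : Balanced x₀) (X : Finset (α → Bool)) :
    ∑ φ : α ≃ β × Bool, (X ∩ pairedSet φ).card =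
      (univ.filter fun φ : α ≃ β × Bool => x₀ ∈ pairedSet φ).card * (X.filter Balanced).card := by
  classical
  have h1 : ∀ φ : α ≃ β × Bool, (X ∩ pairedSet φ).card =
      ∑ x ∈ X, if x ∈ pairedSet φ then 1 else 0 := by
    intro φ
    rw [← Finset.filter_mem_eq_inter, Finset.card_filter]
  simp_rw [h1]
  rw [Finset.sum_comm]
  have h2 : ∀ x ∈ X, (∑ φ : α ≃ β × Bool, if x ∈ pairedSet φ then 1 else 0) =
      if Balanced x then (univ.filter fun φ : α ≃ β × Bool => x₀ ∈ pairedSet φ).card else 0 := by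
    intro x _
    rw [← Finset.card_filter]
    split_ifs with hb
    · obtain ⟨σ, hσ⟩ := exists_perm_of_balanced hb hx₀
      rw [← card_pairings_comp σ x, hσ]
    · rw [Finset.card_eq_zero, Finset.filter_eq_empty_iff]
      intro φ _ hφ
      exact hb (balanced_of_mem_pairedSet φ hφ)
  rw [Finset.sum_congr rfl h2, ← Finset.sum_filter, Finset.sum_const, smul_eq_mul, mul_comm]

/-- A balanced configuration admits a pairing with one `1` per pair. [folklore] -/
theorem exists_pairing {x₀ : α → Bool} (hx₀ : Balanced x₀) :
    ∃ φ : α ≃ {a // x₀ a = true} × Bool, x₀ ∈ pairedSet φ := by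
  have hc : Fintype.card {a // ¬ x₀ a = true} = Fintype.card {a // x₀ a = true} := by
    rw [Fintype.card_subtype_compl, Fintype.card_subtype]
    unfold Balanced ones at hx₀
    omega
  let e₀ : {a // ¬ x₀ a = true} ≃ {a // x₀ a = true} := Fintype.equivOfCardEq hc
  let φ : α ≃ {a // x₀ a = true} × Bool :=
    { toFun := fun a => if h : x₀ a = true then (⟨a, h⟩, true) else (e₀ ⟨a, h⟩, false)
      invFun := fun q => if q.2 then q.1.1 else (e₀.symm q.1).1
      left_inv := by
        intro a
        by_cases h : x₀ a = true
        · simp [h]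
        · simp [h]
      right_inv := by
        rintro ⟨b, s⟩
        cases s
        · have h : ¬ x₀ (e₀.symm b).1 = true := (e₀.symm b).2
          simp [h]
        · have h : x₀ b.1 = true := b.2
          simp [h] }
  refine ⟨φ, ?_⟩
  simp only [pairedSet, Finset.mem_filter, Finset.mem_univ, true_and]
  intro b
  have h1 : φ.symm (b, true) = b.1 := rfl
  have h2 : φ.symm (b, false) = (e₀.symm b).1 := rfl
  rw [h1, h2, b.2]
  have h3 : ¬ x₀ (e₀.symm b).1 = true := (e₀.symm b).2
  rw [Bool.not_eq_true] at h3
  rw [h3]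
  decide

end Balanced

/-- **Proposition 4** (van den Berg–Jonasson 2012): for increasing `A, B` on the cube `{0,1}^α`,
counting balanced configurations only, `|(A □ B) ∩ Ω_{m/2,m}| ≤ |A ∩ B̄ ∩ Ω_{m/2,m}|` (that is,
`P_{m/2,m}(A □ B) ≤ P_{m/2,m}(A ∩ B̄)`; for odd `m` both sides vanish). [cite: VandenbergJonasson2011, Prop. 4] -/
theorem balancedReimer {A B : Finset (α → Bool)} (hA : IsIncr A) (hB : IsIncr B) :
    ((cubeBox A B).filter Balanced).card ≤ ((A ∩ cubeFlip B).filter Balanced).card := by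
  classical
  by_cases hex : ∃ x₀ : α → Bool, Balanced x₀
  · obtain ⟨x₀, hx₀⟩ := hex
    obtain ⟨φ₀, hφ₀⟩ := exists_pairing hx₀
    have hN : 0 < (univ.filter fun φ : α ≃ {a // x₀ a = true} × Bool => x₀ ∈ pairedSet φ).card :=
      Finset.card_pos.2 ⟨φ₀, Finset.mem_filter.2 ⟨Finset.mem_univ _, hφ₀⟩⟩
    have hle : ∑ φ : α ≃ {a // x₀ a = true} × Bool, (cubeBox A B ∩ pairedSet φ).card ≤
        ∑ φ : α ≃ {a // x₀ a = true} × Bool, (A ∩ cubeFlip B ∩ pairedSet φ).card :=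
      Finset.sum_le_sum fun φ _ => encodedReimer φ hA hB
    rw [sum_card_inter_pairedSet hx₀, sum_card_inter_pairedSet hx₀] at hle
    exact Nat.le_of_mul_le_mul_left hle hN
  · have h0 : (cubeBox A B).filter Balanced = ∅ :=
      Finset.filter_eq_empty_iff.2 fun x _ hb => hex ⟨x, hb⟩
    rw [h0, Finset.card_empty]
    exact Nat.zero_le _

/-! ### Theorem 2 from Proposition 4: the cell decomposition -/

section Cells

/-- "`ω` on `K`, `ω̄` off `K`": the second member of the cell of `(ω, ·)` with agreement set `K`.
[cite: VandenbergJonasson2011, §3.1 (cells W_α)] -/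
def mirror (K : Finset α) (ω : α → Bool) : α → Bool := fun a => if a ∈ K then ω a else !ω a

/-- The agreement set of a pair recovers the second member by mirroring. [cite: VandenbergJonasson2011, §3.1] -/
theorem mirror_agree (ω ω' : α → Bool) :
    mirror (univ.filter fun a => ω a = ω' a) ω = ω' := by
  funext a
  simp only [mirror, Finset.mem_filter, Finset.mem_univ, true_and]
  by_cases h : ω a = ω' a
  · simp [h]
  · rw [if_neg h]
    cases h1 : ω a <;> cases h2 : ω' a <;> simp_all

/-- The agreement set of `(ω, mirror K ω)` is `K`. [cite: VandenbergJonasson2011, §3.1] -/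
theorem agree_mirror (K : Finset α) (ω : α → Bool) :
    (univ.filter fun a => ω a = mirror K ω a) = K := by
  ext a
  simp only [Finset.mem_filter, Finset.mem_univ, true_and, mirror]
  by_cases h : a ∈ K
  · simp [h]
  · simp only [h, if_false, iff_false]
    cases ω a <;> simp

/-- Every configuration is `mirror K ω` for exactly one `K`: `|Y| = |{K | mirror K ω ∈ Y}|`.
[cite: VandenbergJonasson2011, §3.1 (the cells partition Ω × Ω)] -/
theorem card_eq_card_filter_mirror (Y : Finset (α → Bool)) (ω : α → Bool) :
    (univ.filter fun K : Finset α => mirror K ω ∈ Y).card = Y.card := by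
  refine Finset.card_bij' (fun K _ => mirror K ω) (fun ω' _ => univ.filter fun a => ω a = ω' a)
    (fun K hK => (Finset.mem_filter.1 hK).2) (fun ω' hω' => ?_) (fun K _ => agree_mirror K ω)
    (fun ω' _ => mirror_agree ω ω')
  exact Finset.mem_filter.2 ⟨Finset.mem_univ _, by rw [mirror_agree]; exact hω'⟩

/-- **The cell decomposition**: `|X| · |Y| = Σ_K |{ω ∈ X | mirror_K ω ∈ Y}|` (the bijection
`(ω, ω') ↦ (K, ω)`, `K` the agreement set). [cite: VandenbergJonasson2011, §3.1] -/
theorem card_mul_card_eq_sum_mirror (X Y : Finset (α → Bool)) :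
    X.card * Y.card = ∑ K : Finset α, (X.filter fun ω => mirror K ω ∈ Y).card := by
  have h1 : ∀ K : Finset α, (X.filter fun ω => mirror K ω ∈ Y).card =
      ∑ ω ∈ X, if mirror K ω ∈ Y then 1 else 0 := fun K => Finset.card_filter _ _
  simp_rw [h1]
  rw [Finset.sum_comm]
  have h2 : ∀ ω ∈ X, (∑ K : Finset α, if mirror K ω ∈ Y then 1 else 0) = Y.card := by
    intro ω _
    rw [← Finset.card_filter, card_eq_card_filter_mirror]
  rw [Finset.sum_congr rfl h2, Finset.sum_const, smul_eq_mul]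

variable (K : Finset α)

/-- Extension of a configuration on the coordinates off `K` by the base values `u` on `K`
(the paper's `γ ∘ α`). [cite: VandenbergJonasson2011, §3.1 (γ ∘ α)] -/
def ext (u : α → Bool) (g : {a // a ∉ K} → Bool) : α → Bool :=
  fun a => if h : a ∈ K then u a else g ⟨a, h⟩

/-- The base of a configuration: its values on `K`, zero elsewhere. [cite: VandenbergJonasson2011, §3.1 (α = ω_K)] -/
def base (ω : α → Bool) : α → Bool := fun a => if a ∈ K then ω a else false

/-- The restriction of a configuration to the coordinates off `K`. [cite: VandenbergJonasson2011, §3.1 (ω_{K^c})] -/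
def res (ω : α → Bool) : {a // a ∉ K} → Bool := fun c => ω c.1

omit [Fintype α] in
/-- `ω = (ω_K) ∘ (ω_{Kᶜ})`. [cite: VandenbergJonasson2011, §3.1 (ω = γ ∘ α)] -/
theorem ext_base_res (ω : α → Bool) : ext K (base K ω) (res K ω) = ω := by
  funext a
  unfold ext base res
  by_cases h : a ∈ K <;> simp [h]

omit [Fintype α] in
/-- Restricting an extension off `K` returns the free part. [folklore] -/
theorem res_ext (u : α → Bool) (g : {a // a ∉ K} → Bool) : res K (ext K u g) = g := by
  funext c
  unfold ext res
  simp [c.2]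

omit [Fintype α] in
/-- The base of an extension is the base used (bases vanish off `K`). [folklore] -/
theorem base_ext {u : α → Bool} (hu : ∀ a, a ∉ K → u a = false) (g : {a // a ∉ K} → Bool) :
    base K (ext K u g) = u := by
  funext a
  unfold ext base
  by_cases h : a ∈ K
  · simp [h]
  · simp [h, hu a h]

/-- Bases vanish off `K`. [folklore] -/
theorem base_of_mem_image {u : α → Bool} (hu : u ∈ univ.image (base K)) :
    ∀ a, a ∉ K → u a = false := by
  obtain ⟨ω, -, rfl⟩ := Finset.mem_image.1 hu
  intro a ha
  simp [base, ha]

/-- The fibre of the base map over a base `u` is parametrised by the configurations off `K`.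
[cite: VandenbergJonasson2011, §3.1] -/
theorem card_filter_base_eq (S : Finset (α → Bool)) {u : α → Bool}
    (hu : ∀ a, a ∉ K → u a = false) :
    (S.filter fun ω => base K ω = u).card =
      (univ.filter fun g : {a // a ∉ K} → Bool => ext K u g ∈ S).card := by
  have hinj : Function.Injective (ext K u) := by
    intro g g' h
    have := congrArg (res K) h
    rwa [res_ext, res_ext] at this
  rw [← Finset.card_image_of_injective (univ.filter fun g : {a // a ∉ K} → Bool => ext K u g ∈ S) hinj]
  congr 1
  ext ω
  simp only [Finset.mem_filter, Finset.mem_image, Finset.mem_univ, true_and]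
  constructor
  · rintro ⟨hS, hb⟩
    refine ⟨res K ω, ?_, ?_⟩
    · rw [← hb, ext_base_res]; exact hS
    · rw [← hb, ext_base_res]
  · rintro ⟨g, hg, rfl⟩
    exact ⟨hg, base_ext K hu g⟩

/-- Counting a set of configurations fibrewise over the bases. [cite: VandenbergJonasson2011, §3.1] -/
theorem card_eq_sum_base (S : Finset (α → Bool)) :
    S.card = ∑ u ∈ univ.image (base K),
      (univ.filter fun g : {a // a ∉ K} → Bool => ext K u g ∈ S).card := by
  rw [Finset.card_eq_sum_card_fiberwise (f := base K) (s := S) (t := univ.image (base K))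
    (fun ω _ => Finset.mem_coe.2 (Finset.mem_image_of_mem _ (Finset.mem_univ ω)))]
  refine Finset.sum_congr rfl fun u hu => ?_
  exact card_filter_base_eq K S (base_of_mem_image K hu)

omit [Fintype α] in
/-- Mirroring an extension complements its free part: `mirror_K (γ ∘ α) = γ̄ ∘ α`.
[cite: VandenbergJonasson2011, §3.1 ((ω, ω') ∈ W_α ⟹ ω'_{Kᶜ} = overline{ω_{Kᶜ}})] -/
theorem mirror_ext (u : α → Bool) (g : {a // a ∉ K} → Bool) :
    mirror K (ext K u g) = ext K u (flipAll g) := by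
  funext a
  unfold mirror ext flipAll
  by_cases h : a ∈ K <;> simp [h]

/-- `|γ ∘ α| = |α| + |γ|` (number of ones). [cite: VandenbergJonasson2011, §3.1 ((14))] -/
theorem card_ones_ext {u : α → Bool} (hu : ∀ a, a ∉ K → u a = false) (g : {a // a ∉ K} → Bool) :
    (ones (ext K u g)).card = (ones u).card + (ones g).card := by
  rw [← Finset.card_filter_add_card_filter_not (s := ones (ext K u g)) (fun a => a ∈ K)]
  congr 1
  · congr 1
    ext a
    simp only [ones, Finset.mem_filter, Finset.mem_univ, true_and, ext]
    by_cases h : a ∈ K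
    · simp [h]
    · simp [h, hu a h]
  · rw [← Finset.card_map (Function.Embedding.subtype fun a => a ∉ K) (s := ones g)]
    congr 1
    ext a
    simp only [ones, Finset.mem_filter, Finset.mem_univ, true_and, ext, Finset.mem_map,
      Function.Embedding.subtype_apply]
    constructor
    · rintro ⟨h1, h2⟩
      rw [dif_neg h2] at h1
      exact ⟨⟨a, h2⟩, h1, rfl⟩
    · rintro ⟨c, hc, rfl⟩
      refine ⟨?_, c.2⟩
      rw [dif_neg c.2]; exact hc

omit [DecidableEq α] in
/-- `|γ| + |γ̄| = |Kᶜ|`. [cite: VandenbergJonasson2011, §3.1 ((15))] -/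
theorem card_ones_add_card_ones_flipAll (g : α → Bool) :
    (ones g).card + (ones (flipAll g)).card = Fintype.card α := by
  have h := Finset.card_filter_add_card_filter_not (s := (univ : Finset α)) (fun a => g a = true)
  rw [Finset.card_univ] at h
  have e : ones (flipAll g) = univ.filter (fun a => ¬ g a = true) := by
    ext a; simp [ones, flipAll]
  rw [e]; exact h

/-- On a cell, membership of both members in the layer `Ω_k` is balance of the free part plus a
condition on the base alone. [cite: VandenbergJonasson2011, §3.1 ((14)–(15))] -/
theorem layer_iff {u : α → Bool} (hu : ∀ a, a ∉ K → u a = false) (g : {a // a ∉ K} → Bool) (k : ℕ) :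
    (ext K u g ∈ layer k ∧ ext K u (flipAll g) ∈ layer k) ↔
      (Balanced g ∧ ((ones u).card ≤ k ∧ 2 * (k - (ones u).card) = Fintype.card {a // a ∉ K})) := by
  simp only [layer, Finset.mem_filter, Finset.mem_univ, true_and, Balanced]
  rw [card_ones_ext K hu, card_ones_ext K hu]
  have h := card_ones_add_card_ones_flipAll g
  constructor
  · rintro ⟨h1, h2⟩
    refine ⟨by omega, by omega, by omega⟩
  · rintro ⟨h1, h2, h3⟩
    constructor <;> omega

/-- Sections `A(α) = {γ | γ ∘ α ∈ A}` of an increasing event are increasing.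
[cite: VandenbergJonasson2011, §3.1 ("A(α) and B(α) are increasing")] -/
theorem isIncr_section {A : Finset (α → Bool)} (hA : IsIncr A) (u : α → Bool) :
    IsIncr (univ.filter fun g : {a // a ∉ K} → Bool => ext K u g ∈ A) := by
  intro g g' hle hg
  rw [Finset.mem_filter] at hg ⊢
  refine ⟨Finset.mem_univ _, hA ?_ hg.2⟩
  intro a
  unfold ext
  by_cases h : a ∈ K
  · simp [h]
  · simp only [h, dif_neg, not_false_eq_true]; exact hle _

/-- `(A □ B)(α) ⊆ A(α) □ B(α)` (sections of a disjoint occurrence). [cite: VandenbergJonasson2011, §3.1] -/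
theorem section_cubeBox_subset (A B : Finset (α → Bool)) (u : α → Bool) :
    (univ.filter fun g : {a // a ∉ K} → Bool => ext K u g ∈ cubeBox A B) ⊆
      cubeBox (univ.filter fun g : {a // a ∉ K} → Bool => ext K u g ∈ A)
        (univ.filter fun g : {a // a ∉ K} → Bool => ext K u g ∈ B) := by
  intro g hg
  rw [Finset.mem_filter] at hg
  obtain ⟨K₀, hKA, hKB⟩ := mem_cubeBox.1 hg.2
  rw [mem_cubeBox]
  refine ⟨univ.filter fun c : {a // a ∉ K} => c.1 ∈ K₀, ?_, ?_⟩
  · intro z hz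
    rw [Finset.mem_filter]
    refine ⟨Finset.mem_univ _, hKA _ fun a ha => ?_⟩
    unfold ext
    by_cases h : a ∈ K
    · simp [h]
    · simp only [h, dif_neg, not_false_eq_true]
      exact hz ⟨a, h⟩ (Finset.mem_filter.2 ⟨Finset.mem_univ _, ha⟩)
  · intro z hz
    rw [Finset.mem_filter]
    refine ⟨Finset.mem_univ _, hKB _ fun a ha => ?_⟩
    unfold ext
    by_cases h : a ∈ K
    · simp [h]
    · simp only [h, dif_neg, not_false_eq_true]
      exact hz ⟨a, h⟩ (fun h' => ha (Finset.mem_filter.1 h').2)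

/-- `A(α) ∩ overline{B(α)} = {γ | γ ∘ α ∈ A, γ̄ ∘ α ∈ B}`. [cite: VandenbergJonasson2011, §3.1 ((13), right side)] -/
theorem section_inter_cubeFlip (A B : Finset (α → Bool)) (u : α → Bool) :
    (univ.filter fun g : {a // a ∉ K} → Bool => ext K u g ∈ A) ∩
        cubeFlip (univ.filter fun g : {a // a ∉ K} → Bool => ext K u g ∈ B) =
      univ.filter fun g : {a // a ∉ K} → Bool => ext K u g ∈ A ∧ ext K u (flipAll g) ∈ B := by
  ext g
  rw [Finset.mem_inter, mem_cubeFlip, Finset.mem_filter, Finset.mem_filter, Finset.mem_filter]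
  simp

/-- **The comparison on one cell** (van den Berg–Jonasson 2012, §3.1, (13)): for every agreement set
`K`, the number of `ω ∈ (A □ B) ∩ Ω_k` with `mirror_K ω ∈ Ω_k` is at most the number of
`ω ∈ A ∩ Ω_k` with `mirror_K ω ∈ B ∩ Ω_k`. [cite: VandenbergJonasson2011, §3.1] -/
theorem cell_le {A B : Finset (α → Bool)} (hA : IsIncr A) (hB : IsIncr B) (k : ℕ) :
    ((cubeBox A B ∩ layer k).filter fun ω => mirror K ω ∈ layer k).card ≤
      ((A ∩ layer k).filter fun ω => mirror K ω ∈ B ∩ layer k).card := by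
  rw [card_eq_sum_base K, card_eq_sum_base K]
  refine Finset.sum_le_sum fun u hu => ?_
  have hu' := base_of_mem_image K hu
  set P : Prop := (ones u).card ≤ k ∧ 2 * (k - (ones u).card) = Fintype.card {a // a ∉ K} with hP
  set Au := univ.filter fun g : {a // a ∉ K} → Bool => ext K u g ∈ A with hAu
  set Bu := univ.filter fun g : {a // a ∉ K} → Bool => ext K u g ∈ B with hBu
  -- rewrite both fibres through `layer_iff`
  have hL : (univ.filter fun g : {a // a ∉ K} → Bool =>
      ext K u g ∈ (cubeBox A B ∩ layer k).filter fun ω => mirror K ω ∈ layer k) =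
      (univ.filter fun g : {a // a ∉ K} → Bool => ext K u g ∈ cubeBox A B).filter
        fun g => Balanced g ∧ P := by
    ext g
    simp only [Finset.mem_filter, Finset.mem_univ, true_and, Finset.mem_inter, mirror_ext]
    have h := layer_iff K hu' g k
    constructor
    · rintro ⟨⟨h1, h2⟩, h3⟩
      exact ⟨h1, h.1 ⟨h2, h3⟩⟩
    · rintro ⟨h1, h2⟩
      have h' := h.2 h2
      exact ⟨⟨h1, h'.1⟩, h'.2⟩
  have hR : (univ.filter fun g : {a // a ∉ K} → Bool =>
      ext K u g ∈ (A ∩ layer k).filter fun ω => mirror K ω ∈ B ∩ layer k) =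
      (Au ∩ cubeFlip Bu).filter fun g => Balanced g ∧ P := by
    rw [section_inter_cubeFlip]
    ext g
    simp only [Finset.mem_filter, Finset.mem_univ, true_and, Finset.mem_inter, mirror_ext]
    have h := layer_iff K hu' g k
    constructor
    · rintro ⟨⟨h1, h2⟩, h3, h4⟩
      exact ⟨⟨h1, h3⟩, h.1 ⟨h2, h4⟩⟩
    · rintro ⟨⟨h1, h3⟩, h2⟩
      have h' := h.2 h2
      exact ⟨⟨h1, h'.1⟩, h3, h'.2⟩
  rw [hL, hR]
  by_cases hPu : P
  · have e1 : ∀ S : Finset ({a // a ∉ K} → Bool),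
        S.filter (fun g => Balanced g ∧ P) = S.filter Balanced := by
      intro S
      exact Finset.filter_congr fun g _ => by simp [hPu]
    rw [e1, e1]
    calc ((univ.filter fun g : {a // a ∉ K} → Bool => ext K u g ∈ cubeBox A B).filter Balanced).card
        ≤ ((cubeBox Au Bu).filter Balanced).card :=
          Finset.card_le_card (Finset.filter_subset_filter _ (section_cubeBox_subset K A B u))
      _ ≤ ((Au ∩ cubeFlip Bu).filter Balanced).card :=
          balancedReimer (isIncr_section K hA u) (isIncr_section K hB u)
  · have e0 : ∀ S : Finset ({a // a ∉ K} → Bool), S.filter (fun g => Balanced g ∧ P) = ∅ := by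
      intro S
      exact Finset.filter_eq_empty_iff.2 fun g _ h => hPu h.2
    rw [e0, e0]

end Cells

/-- **van den Berg–Jonasson 2012, Theorem 2 (counting form).** For increasing `A, B` on the cube
`{0,1}^α` and every `k`: `|(A □ B) ∩ Ω_k| · |Ω_k| ≤ |A ∩ Ω_k| · |B ∩ Ω_k|`, i.e. the `k`-out-of-`n`
measure `P_{k,n}` (uniform on the configurations with exactly `k` ones) satisfies the BK inequality
`P_{k,n}(A □ B) ≤ P_{k,n}(A) P_{k,n}(B)`. [cite: VandenbergJonasson2011, Thm. 2] -/
theorem bk_kOutOfN_card {A B : Finset (α → Bool)} (hA : IsIncr A) (hB : IsIncr B) (k : ℕ) :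
    (cubeBox A B ∩ layer k).card * (layer k : Finset (α → Bool)).card ≤
      (A ∩ layer k).card * (B ∩ layer k).card := by
  rw [card_mul_card_eq_sum_mirror, card_mul_card_eq_sum_mirror]
  exact Finset.sum_le_sum fun K _ => cell_le K hA hB k

/-- **van den Berg–Jonasson 2012, Theorem 2 (probability form).** With `P_{k,n}(X) = |X ∩ Ω_k| / |Ω_k|`:
`P_{k,n}(A □ B) ≤ P_{k,n}(A) · P_{k,n}(B)` for increasing `A, B`. [cite: VandenbergJonasson2011, Thm. 2] -/
theorem bk_kOutOfN {A B : Finset (α → Bool)} (hA : IsIncr A) (hB : IsIncr B) (k : ℕ) :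
    ((cubeBox A B ∩ layer k).card : ℝ) / (layer k : Finset (α → Bool)).card ≤
      ((A ∩ layer k).card : ℝ) / (layer k : Finset (α → Bool)).card *
        (((B ∩ layer k).card : ℝ) / (layer k : Finset (α → Bool)).card) := by
  have h := bk_kOutOfN_card hA hB k
  rcases Nat.eq_zero_or_pos (layer k : Finset (α → Bool)).card with h0 | hpos
  · simp [h0]
  · have hL : (0 : ℝ) < (layer k : Finset (α → Bool)).card := by exact_mod_cast hpos
    rw [div_mul_div_comm, div_le_div_iff₀ hL (mul_pos hL hL)]
    have h' : ((cubeBox A B ∩ layer k).card : ℝ) * (layer k : Finset (α → Bool)).card ≤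
        ((A ∩ layer k).card : ℝ) * (B ∩ layer k).card := by exact_mod_cast h
    nlinarith [h']

end VandenBergJonasson2012

end Literature.Probability.LatticeModels
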